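import Mathlib.RepresentationTheory.Coinvariants
import Mathlib.LinearAlgebra.Eigenspace.Charpoly
import Mathlib.LinearAlgebra.Charpoly.BaseChange
import Mathlib.Algebra.Polynomial.Reverse
import Mathlib.Algebra.Polynomial.Degree.SmallDegree
import Mathlib.Algebra.Ring.GeomSum
import Literature.NumberTheory.EllipticCurves.HasseWeilAbelian
import HarnessLib

/-!
# Coinvariants of a representation under a cyclically generated normal subgroup: dimension, and the
# eigenvalues of the induced action are eigenvalues upstairs (folklore linear algebra)

Cell `pub/bsd-wall` (D-0145 line `route-BirchSwinnertonDyer-CyclotomicUntwist`), seat `bsd-line-cycu-p1`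
(K1/K2 LEAD lineage, gen 8). THEOREMS ONLY (no definition, no named fact, no `sorry`); helper toward the crux
child C1 = stmt-BirchSwinnertonDyer-27548 (`PSUntwistedLFunctionAtThree`) through its print layer (★)/(T):
«`a₃(g₀)` is a root of `X² − a_w(W)·X + 3` for the untwist `g₀ = (f_W ⊗ η̄)^{new}`» (memo
`Cruxes/PSRankOneLowerHalfAtThree/LAW-La3-KERNEL-v3.md` §9, the `ℓ`-adic proof). BSD is not proved by this
file; no crux and no child of the route is proved by it.

WHAT. Pure representation theory over a field `K`, for a representation `ρ : G →* End_K(V)` on a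
finite-dimensional `V`, a normal subgroup `S ⊴ G` and the induced action `ρ.toCoinvariants S` of `G` on
the coinvariants `V_S = V ⧸ ⟨ρ(s)v − v⟩` (Mathlib `Representation.Coinvariants`, `Representation.toCoinvariants`):

* §1 `ker_eq_range_of_forall_eq_pow` — if every `ρ(s)`, `s ∈ S`, is a power of `ρ(τ)` for one `τ ∈ S`
  (the action of `S` factors through a cyclic group generated by the image of `τ`), the augmentation
  submodule is `range (ρ τ − 1)`; hence `finrank V_S = finrank ker (ρ τ − 1)`
  (`finrank_coinvariants_eq_finrank_ker`) and `V_S ≠ 0` as soon as `ρ(τ)` fixes a non-zero vector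
  (`finrank_coinvariants_pos_of_fixed`).
* §2 `hasEigenvalue_of_hasEigenvalue_toCoinvariants` — an eigenvalue of `σ ∈ G` on `V_S` is an eigenvalue
  of `ρ(σ)` on `V` (the augmentation submodule is `ρ(σ)`-stable and `V` is finite-dimensional); with
  `finrank V_S = 1`: `exists_charpoly_toCoinvariants_eq_X_sub_C`.
* §3 `finrank_le_one_of_charpoly_reverse_eq`, `charpoly_eq_X_sub_C_of_charpoly_reverse_eq` — reading an
  Euler factor `det(1 − σT | V_S) = 1 − aT` of degree `≤ 1`: the coinvariants have dimension `≤ 1`, and in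
  dimension `1` the characteristic polynomial of `σ` on `V_S` is `X − a`.
* §4 `isRoot_charpoly_of_charpoly_reverse_toCoinvariants_eq` — the combination used at an additive prime:
  cyclic inertia action through `τ`, a `ρ(τ)`-fixed vector, and the Euler factor `1 − aT` of `σ` on `V_S`
  force `finrank V_S = 1` and `charpoly(ρ σ)(a) = 0`.
* §5 `isRoot_charpoly_of_charpoly_reverse_toInertiaCoinvariants_eq` — the same in the tree's currency of
  `ContinuousRep.toInertiaCoinvariants ρ 𝔓` (`HasseWeilAbelian`: decomposition group `D_𝔓`, inertia
  `I_𝔓 ⊴ D_𝔓`, the coinvariant Euler factor of `Carayol1986_eulerFactor` /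
  `map_reverse_charpoly_toInertiaCoinvariants_twist_eq`).

Consumer (planned, lead memo STAR-PRINT-LAYER): with `ρ = (V_ℓ(W) ⊗ ψ_{η̄})|_{D_𝔔}` at a prime `𝔔 ∣ 3`,
`S = I_𝔔`, Carayol's Euler factor `1 − a₃(g₀)T` on the coinvariants (tree engine
`map_reverse_charpoly_toInertiaCoinvariants_twist_eq` + named fact `Carayol1986_eulerFactor`) and an arithmetic
Frobenius `σ` fixing `ζ₉` (charpoly `X² − a_w X + 3` by `frobeniusTraceAt_baseChange_eq_psUntwistedTrace`),
§4 yields (T). References: [cite: SerreLocalFields1979, Ch. I §7] (decomposition/inertia, coinvariants) ·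
[cite: CarayolASENS1986, Thm. (A)] (the Euler-factor reading) · Serre, *Facteurs locaux des fonctions zêta*
(1970), n° 2.1–2.3 (`L_v(V,T) = det(1 − σT | V_{I})`).
-/

set_option autoImplicit false
-- single-conjunct summit: `Summit.BirchSwinnertonDyer.BirchSwinnertonDyer.…` repeats the name by design
set_option linter.dupNamespace false

open Polynomial Module

namespace Summit.BirchSwinnertonDyer.BirchSwinnertonDyer.Theorems.CoinvariantEigenvalue

variable {K : Type*} [Field K] {G : Type*} [Group G] {V : Type*} [AddCommGroup V] [Module K V]

/-! ### §1 The augmentation submodule of a cyclically generated action -/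

/-- If every `ρ(s)`, `s ∈ S`, is a power of `ρ(τ)` for a fixed `τ ∈ S`, the augmentation submodule
`⟨ρ(s)v − v : s ∈ S⟩` of `ρ|_S` is the range of `ρ(τ) − 1` (`ρ(τ)^j − 1 = (ρ(τ) − 1)·∑_{i<j} ρ(τ)^i`).
[cite: SerreLocalFields1979, Ch. I §7] -/
theorem ker_eq_range_of_forall_eq_pow (ρ : Representation K G V) (S : Subgroup G) {τ : G} (hτ : τ ∈ S)
    (hcyc : ∀ s ∈ S, ∃ j : ℕ, ρ s = ρ τ ^ j) :
    Representation.Coinvariants.ker (ρ.comp S.subtype) = LinearMap.range (ρ τ - 1) := by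
  apply le_antisymm
  · refine Submodule.span_le.2 ?_
    rintro _ ⟨⟨s, x⟩, rfl⟩
    obtain ⟨j, hj⟩ := hcyc s s.2
    refine ⟨(∑ i ∈ Finset.range j, ρ τ ^ i) x, ?_⟩
    have hgeom : (ρ τ - 1) * ∑ i ∈ Finset.range j, ρ τ ^ i = ρ τ ^ j - 1 := mul_geom_sum _ _
    change (ρ τ - 1) ((∑ i ∈ Finset.range j, ρ τ ^ i) x) = ρ (S.subtype s) x - x
    rw [← Module.End.mul_apply, hgeom, Subgroup.coe_subtype, hj, LinearMap.sub_apply,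
      Module.End.one_apply]
  · rintro _ ⟨x, rfl⟩
    have h := Representation.Coinvariants.sub_mem_ker (ρ := ρ.comp S.subtype) ⟨τ, hτ⟩ x
    simpa using h

/-- Under cyclic generation by `τ`: `finrank V_S = finrank ker (ρ(τ) − 1)` (rank–nullity).
[cite: SerreLocalFields1979, Ch. I §7] -/
theorem finrank_coinvariants_eq_finrank_ker [FiniteDimensional K V] (ρ : Representation K G V)
    (S : Subgroup G) {τ : G} (hτ : τ ∈ S) (hcyc : ∀ s ∈ S, ∃ j : ℕ, ρ s = ρ τ ^ j) :
    finrank K (Representation.Coinvariants (ρ.comp S.subtype)) =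
      finrank K (LinearMap.ker (ρ τ - 1)) := by
  have h1 : finrank K (Representation.Coinvariants (ρ.comp S.subtype)) +
      finrank K (Representation.Coinvariants.ker (ρ.comp S.subtype)) = finrank K V := by
    unfold Representation.Coinvariants
    exact Submodule.finrank_quotient_add_finrank _
  have h2 := LinearMap.finrank_range_add_finrank_ker (ρ τ - 1)
  rw [ker_eq_range_of_forall_eq_pow ρ S hτ hcyc] at h1
  omega

/-- Under cyclic generation by `τ`, a non-zero `ρ(τ)`-fixed vector makes the coinvariants non-zero:
`0 < finrank V_S`. [cite: SerreLocalFields1979, Ch. I §7] -/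
theorem finrank_coinvariants_pos_of_fixed [FiniteDimensional K V] (ρ : Representation K G V)
    (S : Subgroup G) {τ : G} (hτ : τ ∈ S) (hcyc : ∀ s ∈ S, ∃ j : ℕ, ρ s = ρ τ ^ j)
    {v : V} (hv : v ≠ 0) (hfix : ρ τ v = v) :
    0 < finrank K (Representation.Coinvariants (ρ.comp S.subtype)) := by
  rw [finrank_coinvariants_eq_finrank_ker ρ S hτ hcyc, Module.finrank_pos_iff_exists_ne_zero]
  refine ⟨⟨v, ?_⟩, fun h => hv (congrArg Subtype.val h)⟩
  rw [LinearMap.mem_ker, LinearMap.sub_apply, hfix, Module.End.one_apply, sub_self]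

/-! ### §2 Eigenvalues of the induced action on coinvariants are eigenvalues upstairs -/

/-- **An eigenvalue of `σ` on the coinvariants `V_S` is an eigenvalue of `ρ(σ)` on `V`** (`S ⊴ G`, `V`
finite-dimensional over a field): the augmentation submodule `U` is `ρ(σ)`-stable, so if `ρ(σ) − μ` were
injective it would be bijective on `U`, and an eigenvector class `v̄` (with `(ρ(σ) − μ)v ∈ U`) would give
`v ∈ U`, `v̄ = 0`. [cite: SerreLocalFields1979, Ch. I §7] -/
theorem hasEigenvalue_of_hasEigenvalue_toCoinvariants [FiniteDimensional K V] (ρ : Representation K G V)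
    (S : Subgroup G) [S.Normal] (σ : G) {μ : K}
    (h : Module.End.HasEigenvalue (ρ.toCoinvariants S σ) μ) : Module.End.HasEigenvalue (ρ σ) μ := by
  classical
  by_contra hμ
  set U := Representation.Coinvariants.ker (ρ.comp S.subtype) with hU
  set g : Module.End K V := ρ σ - μ • 1 with hg
  -- `g` is injective since `μ` is not an eigenvalue
  have hginj : Function.Injective g := by
    rw [← LinearMap.ker_eq_bot]
    by_contra hne
    exact hμ (Module.End.hasEigenvalue_iff.mpr (by rwa [Module.End.eigenspace_def]))
  -- `U` is `g`-stable
  have hstab : ∀ u ∈ U, g u ∈ U := by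
    intro u hu
    have h1 : ρ σ u ∈ U := Representation.Coinvariants.le_comap_ker ρ S σ hu
    simpa [hg] using U.sub_mem h1 (U.smul_mem μ hu)
  -- hence `g` restricted to `U` is surjective onto `U`
  have hsurj : Function.Surjective (g.restrict hstab) := by
    rw [← LinearMap.injective_iff_surjective]
    intro a b hab
    apply Subtype.ext
    apply hginj
    simpa [LinearMap.restrict_apply] using congrArg Subtype.val hab
  -- an eigenvector class
  obtain ⟨w, hw⟩ := h.exists_hasEigenvector
  obtain ⟨v, rfl⟩ := Representation.Coinvariants.mk_surjective _ w
  have hwU : g v ∈ U := by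
    have h1 := hw.1
    rw [Module.End.mem_eigenspace_iff, Representation.toCoinvariants_mk, ← map_smul, ← sub_eq_zero,
      ← map_sub, Representation.Coinvariants.mk_eq_zero] at h1
    simpa [hg] using h1
  obtain ⟨⟨u, hu⟩, hgu⟩ := hsurj ⟨g v, hwU⟩
  have huv : u = v := hginj (by simpa [LinearMap.restrict_apply] using congrArg Subtype.val hgu)
  apply hw.2
  rw [Representation.Coinvariants.mk_eq_zero]
  simpa [huv] using hu

/-- In dimension one: if `finrank V_S = 1`, the characteristic polynomial of `σ` on `V_S` is `X − c` for a
`c` which is a root of the characteristic polynomial of `ρ(σ)` on `V`. [cite: SerreLocalFields1979, Ch. I §7] -/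
theorem exists_charpoly_toCoinvariants_eq_X_sub_C [FiniteDimensional K V] (ρ : Representation K G V)
    (S : Subgroup G) [S.Normal] (σ : G)
    (h1 : finrank K (Representation.Coinvariants (ρ.comp S.subtype)) = 1) :
    ∃ c : K, (ρ.toCoinvariants S σ).charpoly = X - C c ∧ (ρ σ).charpoly.IsRoot c := by
  set f : Module.End K (Representation.Coinvariants (ρ.comp S.subtype)) := ρ.toCoinvariants S σ
  have hdeg : f.charpoly.natDegree = 1 := by rw [LinearMap.charpoly_natDegree, h1]
  have hf : f.charpoly = X - C (-(f.charpoly.coeff 0)) := by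
    rw [map_neg, sub_neg_eq_add]; exact (LinearMap.charpoly_monic f).eq_X_add_C hdeg
  refine ⟨-(f.charpoly.coeff 0), hf, ?_⟩
  rw [← Module.End.hasEigenvalue_iff_isRoot_charpoly]
  apply hasEigenvalue_of_hasEigenvalue_toCoinvariants ρ S σ
  rw [Module.End.hasEigenvalue_iff_isRoot_charpoly]
  change f.charpoly.IsRoot _
  rw [hf]
  simp

/-! ### §3 Reading a degree-`≤ 1` Euler factor on the coinvariants -/

/-- For an INVERTIBLE endomorphism `f` of a finite-dimensional space `W`: if `det(1 − fT) = f.charpoly.reverse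
= 1 − aT`, then `finrank W ≤ 1` (the reverse of the characteristic polynomial of an automorphism has degree
`finrank W`, its constant coefficient `± det f` being non-zero).
[cite: CarayolASENS1986, Thm. (A) (the Euler factor has degree ≤ 1 at a prime dividing the level)] -/
theorem finrank_le_one_of_charpoly_reverse_eq {W : Type*} [AddCommGroup W] [Module K W]
    [FiniteDimensional K W] (f : Module.End K W) (hf : IsUnit f) (a : K)
    (h : f.charpoly.reverse = 1 - C a * X) : finrank K W ≤ 1 := by
  have hdet : f.charpoly.coeff 0 ≠ 0 := by
    intro h0
    have hd := LinearMap.det_eq_sign_charpoly_coeff f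
    rw [h0, mul_zero] at hd
    exact ((LinearMap.isUnit_iff_isUnit_det f).mp hf).ne_zero hd
  have hnat : f.charpoly.reverse.natDegree = finrank K W := by
    rw [Polynomial.reverse_natDegree, LinearMap.charpoly_natDegree,
      Polynomial.natTrailingDegree_eq_zero.mpr (Or.inr hdet), Nat.sub_zero]
  have hle : (1 - C a * X : K[X]).natDegree ≤ 1 := by
    refine (Polynomial.natDegree_sub_le _ _).trans ?_
    simp only [natDegree_one, zero_le, sup_of_le_right]
    exact (Polynomial.natDegree_C_mul_le _ _).trans natDegree_X_le
  rw [← hnat, h]; exact hle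

/-- In dimension one the Euler factor `1 − aT` IS `det(1 − fT) = 1 − (the eigenvalue)·T`: the characteristic
polynomial of `f` is `X − a`. [cite: CarayolASENS1986, Thm. (A)] -/
theorem charpoly_eq_X_sub_C_of_charpoly_reverse_eq {W : Type*} [AddCommGroup W] [Module K W]
    [FiniteDimensional K W] (f : Module.End K W) (a : K)
    (h : f.charpoly.reverse = 1 - C a * X) (h1 : finrank K W = 1) : f.charpoly = X - C a := by
  have hdeg : f.charpoly.natDegree = 1 := by rw [LinearMap.charpoly_natDegree, h1]
  have hc0 : f.charpoly.coeff 0 = -a := by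
    have hc := congrArg (fun q : K[X] => q.coeff 1) h
    simp only [Polynomial.coeff_reverse, hdeg, Polynomial.revAt_le (le_refl 1), Nat.sub_self,
      coeff_sub, coeff_one, one_ne_zero, if_false, coeff_C_mul, coeff_X_one, mul_one, zero_sub] at hc
    exact hc
  rw [(LinearMap.charpoly_monic f).eq_X_add_C hdeg, hc0, map_neg, sub_eq_add_neg]

/-! ### §4 The combination used at an additive prime -/

/-- **Euler factor of degree one on cyclic inertia coinvariants ⇒ its root is a Frobenius eigenvalue.**
Let `S ⊴ G` act on the finite-dimensional `V` through powers of `ρ(τ)` (`τ ∈ S`), let `ρ(τ)` fix a non-zero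
vector, and let `σ ∈ G` have Euler factor `det(1 − σT | V_S) = 1 − aT` on the coinvariants. Then `V_S` is a
LINE, `σ` acts on it by `a`, and `a` is a root of the characteristic polynomial of `ρ(σ)` on `V`.
[cite: SerreLocalFields1979, Ch. I §7] [cite: CarayolASENS1986, Thm. (A)] -/
theorem isRoot_charpoly_of_charpoly_reverse_toCoinvariants_eq [FiniteDimensional K V]
    (ρ : Representation K G V) (S : Subgroup G) [S.Normal] {τ : G} (hτ : τ ∈ S)
    (hcyc : ∀ s ∈ S, ∃ j : ℕ, ρ s = ρ τ ^ j) {v : V} (hv : v ≠ 0) (hfix : ρ τ v = v) (σ : G) (a : K)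
    (h : (ρ.toCoinvariants S σ).charpoly.reverse = 1 - C a * X) :
    finrank K (Representation.Coinvariants (ρ.comp S.subtype)) = 1 ∧
      (ρ.toCoinvariants S σ).charpoly = X - C a ∧ (ρ σ).charpoly.IsRoot a := by
  have hunit : IsUnit (ρ.toCoinvariants S σ) := by
    rw [← Representation.asGroupHom_apply]; exact Units.isUnit _
  have hle := finrank_le_one_of_charpoly_reverse_eq _ hunit a h
  have hpos := finrank_coinvariants_pos_of_fixed ρ S hτ hcyc hv hfix
  have h1 : finrank K (Representation.Coinvariants (ρ.comp S.subtype)) = 1 := le_antisymm hle hpos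
  have hchar := charpoly_eq_X_sub_C_of_charpoly_reverse_eq _ a h h1
  refine ⟨h1, hchar, ?_⟩
  rw [← Module.End.hasEigenvalue_iff_isRoot_charpoly]
  apply hasEigenvalue_of_hasEigenvalue_toCoinvariants ρ S σ
  rw [Module.End.hasEigenvalue_iff_isRoot_charpoly, hchar]
  simp

/-! ### §5 In the tree's currency: `ContinuousRep.toInertiaCoinvariants` -/

/-- **The §4 combination for the inertia coinvariants of a continuous representation** (tree
`ContinuousRep.toInertiaCoinvariants ρ 𝔓 = (ρ|_{D_𝔓}).toCoinvariants I_𝔓`): if the inertia group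
`I_𝔓 ≤ D_𝔓` acts on the finite-dimensional `M` through powers of `ρ(τ)` for one `τ ∈ I_𝔓`, `ρ(τ)` fixes a
non-zero vector, and `σ ∈ D_𝔓` has coinvariant Euler factor `det(1 − σT | M_{I_𝔓}) = 1 − aT`, then
`M_{I_𝔓}` is a line on which `σ` acts by `a`, and `a` is a root of the characteristic polynomial of `ρ(σ)`
on `M`. [cite: SerreLocalFields1979, Ch. I §7] [cite: CarayolASENS1986, Thm. (A)] -/
theorem isRoot_charpoly_of_charpoly_reverse_toInertiaCoinvariants_eq
    {Γ : Type*} [Group Γ] [TopologicalSpace Γ] {A : Type*} [Field A] [TopologicalSpace A]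
    {M : Type*} [AddCommGroup M] [Module A M] [TopologicalSpace M] [FiniteDimensional A M]
    {R : Type*} [CommRing R] [MulSemiringAction Γ R]
    (ρ : Literature.NumberTheory.GaloisRepresentations.ContinuousRep Γ A M) (𝔓 : Ideal R)
    {τ : 𝔓.decompositionSubgroup Γ} (hτ : τ ∈ 𝔓.inertia (𝔓.decompositionSubgroup Γ))
    (hcyc : ∀ s ∈ 𝔓.inertia (𝔓.decompositionSubgroup Γ), ∃ j : ℕ,
      ρ (s : Γ) = ρ (τ : Γ) ^ j)
    {v : M} (hv : v ≠ 0) (hfix : ρ (τ : Γ) v = v) (σ : 𝔓.decompositionSubgroup Γ) (a : A)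
    (h : (ρ.toInertiaCoinvariants 𝔓 σ).charpoly.reverse = 1 - C a * X) :
    finrank A (ρ.InertiaCoinvariants 𝔓) = 1 ∧ (ρ.toInertiaCoinvariants 𝔓 σ).charpoly = X - C a ∧
      (ρ (σ : Γ)).charpoly.IsRoot a := by
  have hcyc' : ∀ s ∈ 𝔓.inertia (𝔓.decompositionSubgroup Γ), ∃ j : ℕ,
      ρ.restrictDecomposition 𝔓 s = ρ.restrictDecomposition 𝔓 τ ^ j := by
    intro s hs
    obtain ⟨j, hj⟩ := hcyc s hs
    refine ⟨j, ?_⟩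
    rw [Literature.NumberTheory.GaloisRepresentations.ContinuousRep.restrictDecomposition_apply,
      Literature.NumberTheory.GaloisRepresentations.ContinuousRep.restrictDecomposition_apply, hj]
  have hfix' : ρ.restrictDecomposition 𝔓 τ v = v := by
    rw [Literature.NumberTheory.GaloisRepresentations.ContinuousRep.restrictDecomposition_apply]; exact hfix
  have key := isRoot_charpoly_of_charpoly_reverse_toCoinvariants_eq (ρ.restrictDecomposition 𝔓)
    (𝔓.inertia (𝔓.decompositionSubgroup Γ)) hτ hcyc' hv hfix' σ a h
  rw [Literature.NumberTheory.GaloisRepresentations.ContinuousRep.restrictDecomposition_apply] at key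
  exact key

end Summit.BirchSwinnertonDyer.BirchSwinnertonDyer.Theorems.CoinvariantEigenvalue
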